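import Summits.HodgeConjecture.HodgeConjecture.Theorems.HodgeLocusCensusUnitColumnChain

/-!
# Hodge locus census — column sums, row sums and strings of the unit-column census matrices (PROBE 36)

certified instances and evidence bearing on the general Hodge conjecture; no claim.  Theorem-only helper sheet of the unit-column line over
anchor 351 `…UnitColumnChain` (its `exists_eq_ofFn_of_mem_iterate`, `sum_map_eq_sum_mul_count`, `val_dual_eq` and the Gorenstein duality
`count_iterate_colR_dual`) and, through it, anchor 229 (`iterate_flatMap_eq`) and gen 31's `colR`; nothing here is a statement about Hodge loci.

WHAT.  The census matrix `M_c` of anchors 229/351 between codegrees `J` (rows `x^v`) and `J + c(e+1)` (columns `x^m`) has the entry «multiplicity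
of `x^v` in `q^c · x^m`», `q = x₁^{e+1} + ⋯ + x_k^{e+1}` on `K[x₁,…,x_k]/(xᵢ^{e+2})`, in the list model (a `colR`-list count).  Write
`z(m) = #{l : m_l = 0}` (zero exponents) and `t(v) = #{l : v_l = e+1}` (top exponents), as counts along the exponent lists, and
`n^(c) = n(n−1)⋯(n−c+1) = c! · C(n, c)` (`Nat.descFactorial`).  This sheet proves, with NO hypothesis on `k, e, c, J`:
  §1 (LEN-1) `length_colR`, (CNT) `count_zero_of_mem_colR`, (LEN) `length_iterate_colR` — the list form of `q^c · x^l` has exactly `z(l)^(c)`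
     entries (the ORDERED choices of the `c` zero exponents raised to `e+1`; each raising removes one zero);
  §2 (COLSUM-ℕ) `sum_count_iterate_colR` — summed over ALL monomials `x^v` the multiplicities of `q^c · x^m` add up to `z(m)^(c)`;
     (COLSUM) `sum_col_eq` — over every field, EVERY COLUMN of `M_c(J → J + c(e+1))` sums to `z(m)^(c) = c! · C(z(m), c)` (cast); (INV-𝟙)
     `one_vecMul_eq` — equivalently the all-ones ROW vector is mapped by `M_c` to the vector `m ↦ c! · C(z(m), c)`;
  §3 (ROWSUM-ℕ) `sum_count_iterate_colR_row`, (ROWSUM) `sum_row_eq`, (INV-𝟙ᵀ) `mulVec_one_eq` — dually EVERY ROW of `M_c` sums to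
     `t(v)^(c) = c! · C(t(v), c)`: (COLSUM-ℕ) for the dual monomial `x^{top − v}` carried through anchor 351's duality `count_iterate_colR_dual`
     and the involution `m ↦ top − m` of the source monomials (`count_zero_dual_eq`: the zeros of `top − v` are the tops of `v`);
  §4 STRINGS: (CNT-j) `count_of_mem_colR`, (SHIFT) `count_of_mem_iterate` — every monomial in the support of `q^c · x^l` has the CONTENT of `l`
     shifted by `−c` zeros and `+c` tops (`#ⱼ(x) + c·[j = 0] = #ⱼ(l) + c·[j = e+1]` for every exponent value `j`); (SUB)
     `sum_subtype_eq_sum_of_count`; (STR-ℕ) `sum_ite_count_iterate_colR` and (STR) `vecMul_indicator_eq` — the indicator ROW vector `χ_n` of a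
     content class `n = (n_0, …, n_{e+1})` (`n_j = #{l : v_l = j}`; the `S_k`-orbit sum, an `S_k`-INVARIANT vector) is mapped by `M_c` to
     `(n_0 + c)^(c) · χ_{n⁺} = c! · C(n_0 + c, c) · χ_{n⁺}`, `n⁺ = n + c·δ_0 − c·δ_{e+1}` (typed without subtraction as the condition
     `#ⱼ(m) + c·[j = e+1] = n_j + c·[j = 0]`; a class with `n_{e+1} < c` is mapped to `0`).
WHY (the `S_k`-invariant line).  (STR) says the `S_k`-INVARIANT vectors of the census complex form a subcomplex of STRINGS (one basis vector `χ_n`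
per content class) on which the census differential acts by the explicit integers `c! · C(n_0 + c, c)`; mod `p` these are a Lucas/Kummer
computation, so the invariant strings have an explicitly computable homology — the next rung.  Honest caveat: (homology of invariants) ≠ (invariants
of homology) when `p ∣ k!`; nothing here is transferred to the full complex.
RELATION TO THE LINE.  Anchor 229 gave the ENTRIES (`c! · [labels agree ∧ Z(v) ⊆ Z(m) ∧ #Z(m) = #Z(v) + c]`) and the RANKS; anchor 351 the
products (chain law) and the transpose pair; this sheet gives the MARGINALS (row and column sums).  Nothing is imported from anchors 345/349/355.
METHOD.  (LEN) by induction on `c` (`iterate_flatMap_eq`, `List.length_flatMap`, (CNT), `Nat.succ_descFactorial_succ`); (COLSUM-ℕ) = (LEN) read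
through anchor 351's `sum_map_eq_sum_mul_count` with the constant weight `1` (every list entry is the exponent list of a monomial,
`exists_eq_ofFn_of_mem_iterate`); (COLSUM): the sum over the codegree-`J` subtype is the sum over all `v` because a monomial in the support has
degree `deg m + c(e+1)` (`Finset.sum_subtype`, `Finset.sum_subset`); (ROWSUM-ℕ): `count_iterate_colR_dual` termwise, `Fintype.sum_bijective` along
`m ↦ top − m` (`Fin.rev_rev`), then (COLSUM-ℕ) and `count_zero_dual_eq` (`count_ofFn_congr`, `val_dual_eq`); (SHIFT) by induction on `c`
(`List.mem_flatMap`, (CNT-j)); (STR-ℕ): on the support the class test of `v` is the shifted-class test of `m` ((SHIFT), `omega`), off it the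
count is `0`; (STR): `Matrix.vecMul` unfolded, (SUB), `Nat.cast_sum`/`Nat.cast_ite`, (STR-ℕ), and `#_0(m) = n_0 + c` from the condition at `j = 0`.
NUMERICS FIRST (owner, file-backed under `HOME/pub-hlocus-ivhs-2/gen58/probe36draft/`): `num36.py` (md5 in the READY line) checks (LEN), (COLSUM),
(ROWSUM) on the LITERAL `colR` lists for all `m, v ∈ {0,…,e+1}^k`: `k ≤ 4, e ≤ 2, c ≤ 3` → 3 × 1 972 instances, `k ≤ 5` → 3 × 7 168, `k ≤ 6, e ≤ 2,
c ≤ 4` → 3 × 33 405 instances, 0 violations; `num36s.py` checks (SHIFT) for every support entry and every `j`, and (STR-ℕ) in exactly the typed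
form (plus `#_0(m)^(c) = (n_0 + c)^(c)` in the «then» case) for every `m` and every content class `n`: `k ≤ 6, e ≤ 2, c ≤ 4` → (SHIFT) 253 946 /
(STR-ℕ) 2 198 290 / (COEF) 16 699 instances, 0 violations (earlier seed `strings36.py`, `k ≤ 4`: 468 classes, 225 nonzero, 0 violations).
LITERATURE (context only; nothing imported or minted): the `S_k`-module structure of inclusion-map homology — V. B. Mnukhin & J. Siemons,
J. Combin. Theory A 74 (1996) 287–300, doi:10.1006/jcta.1996.0051; S. Bell, P. Jones & J. Siemons, J. Algebra 199 (1998) 556–580,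
doi:10.1006/jabr.1997.7189.  No literature fact is used as a hypothesis.
EVIDENCE CLASS: kernel theorems about the census matrices; no census number changes; nothing here asserts anything about the Hodge conjecture.

Import: anchor 351 `…Theorems.HodgeLocusCensusUnitColumnChain` BY NAME; theorem-only, definition-free; Mathlib by name: `List.count_cons`,
`List.length_flatMap`, `List.map_congr_left`, `List.map_const'`, `List.sum_replicate`, `Nat.succ_descFactorial_succ`, `List.ofFn_injective`,
`List.ofFn_succ`, `List.count_eq_zero`, `Finset.sum_subtype`, `Finset.sum_subset`, `Fintype.sum_bijective`, `Fin.rev_rev`, `Matrix.vecMul`,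
`Matrix.mulVec`, `dotProduct`, `List.mem_flatMap`, `List.count_pos_iff`, `Nat.cast_ite`, `Finset.sum_eq_zero`.
-/

set_option linter.dupNamespace false
set_option autoImplicit false

namespace Summit.HodgeConjecture.HodgeConjecture.HodgeLocus.Census.UnitColumnSums

open Summit.HodgeConjecture.HodgeConjecture.HodgeLocus.Census.ModelNonJumpC1All (colR)
open Summit.HodgeConjecture.HodgeConjecture.HodgeLocus.Census.UnitColumnRankLevelsPowers (iterate_flatMap_eq)
open Summit.HodgeConjecture.HodgeConjecture.HodgeLocus.Census.UnitColumnChain (exists_eq_ofFn_of_mem_iterate sum_map_eq_sum_mul_count val_dual_eq count_iterate_colR_dual)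

/-- (LEN-1) the column list of `l` has one entry per zero entry of `l` -/
theorem length_colR (d : ℕ) : ∀ l : List ℕ, (colR d l).length = l.count 0
  | [] => by simp [colR]
  | x :: l => by
      have ih := length_colR d l
      by_cases hx : x = 0
      · subst hx; simp [colR, ih]
      · simp [colR, hx, ih]

/-- (CNT) every entry of the column list of `l` has one zero entry fewer than `l` (the raised exponent `d - 2` is nonzero) -/
theorem count_zero_of_mem_colR (d : ℕ) (hd : d - 2 ≠ 0) : ∀ (l x : List ℕ), x ∈ colR d l → x.count 0 + 1 = l.count 0
  | [], x, hx => by simp [colR] at hx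
  | y :: l, x, hx => by
      rw [colR, List.mem_append, List.mem_map] at hx
      rcases hx with hx | ⟨x', hx', rfl⟩
      · by_cases hy : y = 0
        · subst hy
          simp only [if_true, List.mem_singleton] at hx
          subst hx
          simp [hd]
        · simp [hy] at hx
      · have ih := count_zero_of_mem_colR d hd l x' hx'
        by_cases hy : y = 0
        · subst hy; simp; omega
        · simp [hy]; omega

/-- (LEN) the list form of `q^c · x^l` has exactly `z(z−1)⋯(z−c+1)` entries, `z` = the number of zero exponents of `l`
(`Nat.descFactorial z c = c! · C(z, c)`): the ordered choices of the `c` zero exponents raised to `e + 1`. -/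
theorem length_iterate_colR (e c : ℕ) : ∀ l : List ℕ,
    ((List.flatMap (colR (e + 3)))^[c] [l]).length = (l.count 0).descFactorial c := by
  induction c with
  | zero => intro l; simp
  | succ c ih =>
    intro l
    rw [Function.iterate_succ_apply, List.flatMap_singleton, iterate_flatMap_eq, List.length_flatMap]
    have hcong : List.map (fun x => ((List.flatMap (colR (e + 3)))^[c] [x]).length) (colR (e + 3) l) =
        List.map (fun _ => (l.count 0 - 1).descFactorial c) (colR (e + 3) l) := by
      apply List.map_congr_left
      intro x hx
      have h1 := count_zero_of_mem_colR (e + 3) (by omega) l x hx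
      rw [ih x, show x.count 0 = l.count 0 - 1 by omega]
    rw [hcong, List.map_const', List.sum_replicate, smul_eq_mul, length_colR]
    rcases Nat.eq_zero_or_pos (l.count 0) with h0 | hpos
    · rw [h0]; simp
    · obtain ⟨z, hz⟩ : ∃ z, l.count 0 = z + 1 := ⟨l.count 0 - 1, by omega⟩
      rw [hz, Nat.add_sub_cancel, Nat.succ_descFactorial_succ]
/-- the exponent-list map `v ↦ [v₀, …, v_{k−1}]` is injective -/
theorem ofFn_val_injective (k e : ℕ) :
    Function.Injective (fun v : Fin k → Fin (e + 2) => List.ofFn (fun i => (v i : ℕ))) := by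
  intro v w h
  funext i
  apply Fin.ext
  exact congrFun (List.ofFn_injective h) i

/-- **(COLSUM-ℕ) THE TOTAL MULTIPLICITY OF `q^c · x^m`**: summed over all monomials `x^v`, the multiplicities of anchor 229's closed form add
up to `z(z−1)⋯(z−c+1) = c! · C(z, c)`, `z` = the number of zero exponents of `m` (the length of the list form, (LEN)). -/
theorem sum_count_iterate_colR {k e : ℕ} (c : ℕ) (m : Fin k → Fin (e + 2)) :
    (∑ v : Fin k → Fin (e + 2),
      ((List.flatMap (colR (e + 3)))^[c] [List.ofFn (fun i => (m i : ℕ))]).count (List.ofFn (fun i => (v i : ℕ)))) =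
      ((List.ofFn (fun i => (m i : ℕ))).count 0).descFactorial c := by
  set L := (List.flatMap (colR (e + 3)))^[c] [List.ofFn (fun i => (m i : ℕ))] with hL
  have h := sum_map_eq_sum_mul_count (fun v : Fin k → Fin (e + 2) => List.ofFn (fun i => (v i : ℕ))) (ofFn_val_injective k e)
    (fun _ => 1) L (fun x hx => by obtain ⟨v, hv, -⟩ := exists_eq_ofFn_of_mem_iterate c m x hx; exact ⟨v, hv⟩)
  simp only [one_mul, List.map_const', List.sum_replicate, smul_eq_mul, mul_one] at h
  rw [← h, hL, length_iterate_colR]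

/-- **(COLSUM) EVERY COLUMN OF THE CENSUS MATRIX `M_c` SUMS TO `c! · C(#Z(m), c)`**: at codegrees `J` (rows) and `J + c(e+1)` (columns), over
every field, the column of the source monomial `x^m` sums to `z(z−1)⋯(z−c+1)`, `z` = the number of zero exponents of `m` (cast to `K`). -/
theorem sum_col_eq (K : Type*) [Field K] (k e c J : ℕ)
    (m : {m : Fin k → Fin (e + 2) // (∑ i, (m i : ℕ)) + (J + c * (e + 1)) = k * (e + 1)}) :
    (∑ v : {v : Fin k → Fin (e + 2) // (∑ i, (v i : ℕ)) + J = k * (e + 1)},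
      (Matrix.of fun (v : {v : Fin k → Fin (e + 2) // (∑ i, (v i : ℕ)) + J = k * (e + 1)})
          (m : {m : Fin k → Fin (e + 2) // (∑ i, (m i : ℕ)) + (J + c * (e + 1)) = k * (e + 1)}) =>
        ((((List.flatMap (colR (e + 3)))^[c] [List.ofFn (fun i => (m.1 i : ℕ))]).count (List.ofFn (fun i => (v.1 i : ℕ))) : ℕ) : K))
        v m) =
      ((((List.ofFn (fun i => (m.1 i : ℕ))).count 0).descFactorial c : ℕ) : K) := by
  simp only [Matrix.of_apply]
  rw [← sum_count_iterate_colR c m.1, Nat.cast_sum]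
  rw [← Finset.sum_subtype (Finset.univ.filter (fun v : Fin k → Fin (e + 2) => (∑ i, (v i : ℕ)) + J = k * (e + 1)))
    (fun v => by rw [Finset.mem_filter, and_iff_right (Finset.mem_univ v)])
    (fun v : Fin k → Fin (e + 2) =>
      (((((List.flatMap (colR (e + 3)))^[c] [List.ofFn (fun i => (m.1 i : ℕ))]).count (List.ofFn (fun i => (v i : ℕ))) : ℕ) : K)))]
  apply Finset.sum_subset (Finset.filter_subset _ _)
  intro v _ hv
  rw [Finset.mem_filter, not_and] at hv
  have hP := hv (Finset.mem_univ v)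
  have h0 : ((List.flatMap (colR (e + 3)))^[c] [List.ofFn (fun i => (m.1 i : ℕ))]).count (List.ofFn (fun i => (v i : ℕ))) = 0 := by
    rw [List.count_eq_zero]
    intro hmem
    obtain ⟨w, hw, hdeg⟩ := exists_eq_ofFn_of_mem_iterate c m.1 _ hmem
    have hvw : v = w := ofFn_val_injective k e hw
    subst hvw
    have hm := m.2
    omega
  rw [h0, Nat.cast_zero]

/-- **(INV-𝟙) THE ALL-ONES ROW VECTOR** (the basic `S_k`-invariant vector at codegree `J`) is mapped by `M_c` to the vector
`m ↦ c! · C(#Z(m), c)` — constant on the `S_k`-orbits (content classes) of the source monomials. -/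
theorem one_vecMul_eq (K : Type*) [Field K] (k e c J : ℕ) :
    Matrix.vecMul (fun _ => (1 : K))
      (Matrix.of fun (v : {v : Fin k → Fin (e + 2) // (∑ i, (v i : ℕ)) + J = k * (e + 1)})
          (m : {m : Fin k → Fin (e + 2) // (∑ i, (m i : ℕ)) + (J + c * (e + 1)) = k * (e + 1)}) =>
        ((((List.flatMap (colR (e + 3)))^[c] [List.ofFn (fun i => (m.1 i : ℕ))]).count (List.ofFn (fun i => (v.1 i : ℕ))) : ℕ) : K)) =
    fun m => ((((List.ofFn (fun i => (m.1 i : ℕ))).count 0).descFactorial c : ℕ) : K) := by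
  funext m
  rw [← sum_col_eq K k e c J m, Matrix.vecMul, dotProduct]
  simp only [one_mul]
/-- counting along `List.ofFn`: two exponent lists with matching hit positions have the same count -/
theorem count_ofFn_congr (a b : ℕ) : ∀ (k : ℕ) (g h : Fin k → ℕ), (∀ i, g i = a ↔ h i = b) →
    (List.ofFn g).count a = (List.ofFn h).count b
  | 0, g, h, _ => by simp
  | k + 1, g, h, hgh => by
      rw [List.ofFn_succ, List.ofFn_succ, List.count_cons, List.count_cons,
        count_ofFn_congr a b k (fun i => g i.succ) (fun i => h i.succ) (fun i => hgh i.succ)]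
      have h0 := hgh 0
      by_cases hg : g 0 = a
      · simp [hg, h0.mp hg]
      · have hh : ¬ h 0 = b := fun hb => hg (h0.mpr hb)
        simp [hg, hh]

/-- the zero exponents of the dual monomial `x^{top − v}` are the top exponents (`= e + 1`) of `x^v` -/
theorem count_zero_dual_eq {k e : ℕ} (v : Fin k → Fin (e + 2)) :
    (List.ofFn (fun i => ((Fin.rev (v i) : Fin (e + 2)) : ℕ))).count 0 = (List.ofFn (fun i => (v i : ℕ))).count (e + 1) := by
  apply count_ofFn_congr
  intro i
  rw [val_dual_eq]
  have := (v i).isLt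
  omega

/-- **(ROWSUM-ℕ)**: summed over all source monomials `x^m`, the multiplicities of `x^v` in `q^c · x^m` add up to `t(t−1)⋯(t−c+1) = c! · C(t, c)`,
`t` = the number of TOP exponents (`= e + 1`) of `v` — (COLSUM-ℕ) for the dual monomial `x^{top − v}` through anchor 351's Gorenstein duality
`count_iterate_colR_dual`, the sum re-indexed along the involution `m ↦ top − m`. -/
theorem sum_count_iterate_colR_row {k e : ℕ} (c : ℕ) (v : Fin k → Fin (e + 2)) :
    (∑ m : Fin k → Fin (e + 2),
      ((List.flatMap (colR (e + 3)))^[c] [List.ofFn (fun i => (m i : ℕ))]).count (List.ofFn (fun i => (v i : ℕ)))) =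
      ((List.ofFn (fun i => (v i : ℕ))).count (e + 1)).descFactorial c := by
  simp_rw [count_iterate_colR_dual c _ v]
  rw [← count_zero_dual_eq v, ← sum_count_iterate_colR c (fun i => Fin.rev (v i))]
  exact Fintype.sum_bijective (fun m : Fin k → Fin (e + 2) => fun i => Fin.rev (m i))
    (Function.Involutive.bijective (fun m => funext fun i => Fin.rev_rev (m i))) _ _ (fun m => rfl)

/-- **(ROWSUM) EVERY ROW OF THE CENSUS MATRIX `M_c` SUMS TO `c! · C(#Top(v), c)`**: at codegrees `J` (rows) and `J + c(e+1)` (columns), over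
every field, the row of the target monomial `x^v` sums to `t(t−1)⋯(t−c+1)`, `t` = the number of exponents of `v` equal to `e + 1`. -/
theorem sum_row_eq (K : Type*) [Field K] (k e c J : ℕ)
    (v : {v : Fin k → Fin (e + 2) // (∑ i, (v i : ℕ)) + J = k * (e + 1)}) :
    (∑ m : {m : Fin k → Fin (e + 2) // (∑ i, (m i : ℕ)) + (J + c * (e + 1)) = k * (e + 1)},
      (Matrix.of fun (v : {v : Fin k → Fin (e + 2) // (∑ i, (v i : ℕ)) + J = k * (e + 1)})
          (m : {m : Fin k → Fin (e + 2) // (∑ i, (m i : ℕ)) + (J + c * (e + 1)) = k * (e + 1)}) =>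
        ((((List.flatMap (colR (e + 3)))^[c] [List.ofFn (fun i => (m.1 i : ℕ))]).count (List.ofFn (fun i => (v.1 i : ℕ))) : ℕ) : K))
        v m) =
      ((((List.ofFn (fun i => (v.1 i : ℕ))).count (e + 1)).descFactorial c : ℕ) : K) := by
  simp only [Matrix.of_apply]
  rw [← sum_count_iterate_colR_row c v.1, Nat.cast_sum]
  rw [← Finset.sum_subtype (Finset.univ.filter (fun m : Fin k → Fin (e + 2) => (∑ i, (m i : ℕ)) + (J + c * (e + 1)) = k * (e + 1)))
    (fun m => by rw [Finset.mem_filter, and_iff_right (Finset.mem_univ m)])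
    (fun m : Fin k → Fin (e + 2) =>
      (((((List.flatMap (colR (e + 3)))^[c] [List.ofFn (fun i => (m i : ℕ))]).count (List.ofFn (fun i => (v.1 i : ℕ))) : ℕ) : K)))]
  apply Finset.sum_subset (Finset.filter_subset _ _)
  intro m _ hm
  rw [Finset.mem_filter, not_and] at hm
  have hP := hm (Finset.mem_univ m)
  have h0 : ((List.flatMap (colR (e + 3)))^[c] [List.ofFn (fun i => (m i : ℕ))]).count (List.ofFn (fun i => (v.1 i : ℕ))) = 0 := by
    rw [List.count_eq_zero]
    intro hmem
    obtain ⟨w, hw, hdeg⟩ := exists_eq_ofFn_of_mem_iterate c m _ hmem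
    have hvw : v.1 = w := ofFn_val_injective k e hw
    have hv := v.2
    rw [hvw] at hv
    omega
  rw [h0, Nat.cast_zero]

/-- **(INV-𝟙ᵀ) THE ALL-ONES COLUMN VECTOR** is mapped by `M_c` (acting on columns, `Matrix.mulVec`) to the vector `v ↦ c! · C(#Top(v), c)`. -/
theorem mulVec_one_eq (K : Type*) [Field K] (k e c J : ℕ) :
    Matrix.mulVec
      (Matrix.of fun (v : {v : Fin k → Fin (e + 2) // (∑ i, (v i : ℕ)) + J = k * (e + 1)})
          (m : {m : Fin k → Fin (e + 2) // (∑ i, (m i : ℕ)) + (J + c * (e + 1)) = k * (e + 1)}) =>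
        ((((List.flatMap (colR (e + 3)))^[c] [List.ofFn (fun i => (m.1 i : ℕ))]).count (List.ofFn (fun i => (v.1 i : ℕ))) : ℕ) : K))
      (fun _ => (1 : K)) =
    fun v => ((((List.ofFn (fun i => (v.1 i : ℕ))).count (e + 1)).descFactorial c : ℕ) : K) := by
  funext v
  rw [← sum_row_eq K k e c J v, Matrix.mulVec, dotProduct]
  simp only [mul_one]

/-- (CNT-j) content shift along one raising: an entry `x` of the column list of `l` has one zero entry fewer and one entry `d − 2` more
than `l`, all other multiplicities unchanged (`d − 2 ≠ 0`). -/
theorem count_of_mem_colR (d j : ℕ) (hd : d - 2 ≠ 0) : ∀ (l x : List ℕ), x ∈ colR d l →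
    x.count j + (if j = 0 then 1 else 0) = l.count j + (if j = d - 2 then 1 else 0)
  | [], x, hx => by simp [colR] at hx
  | y :: l, x, hx => by
      rw [colR, List.mem_append, List.mem_map] at hx
      rcases hx with hx | ⟨x', hx', rfl⟩
      · by_cases hy : y = 0
        · subst hy
          simp only [if_true, List.mem_singleton] at hx
          subst hx
          simp only [List.count_cons, beq_iff_eq]
          split_ifs <;> omega
        · simp [hy] at hx
      · have ih := count_of_mem_colR d j hd l x' hx'
        simp only [List.count_cons]
        omega

/-- (SHIFT) content shift along `c` raisings: every entry `x` of the list form of `q^c · x^l` satisfies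
`#ⱼ(x) + c·[j = 0] = #ⱼ(l) + c·[j = e+1]` for every exponent value `j` (`#ⱼ` = number of exponents equal to `j`). -/
theorem count_of_mem_iterate (e j : ℕ) : ∀ (c : ℕ) (l x : List ℕ), x ∈ (List.flatMap (colR (e + 3)))^[c] [l] →
    x.count j + (if j = 0 then c else 0) = l.count j + (if j = e + 1 then c else 0)
  | 0, l, x, hx => by simp at hx; subst hx; simp
  | c + 1, l, x, hx => by
      rw [Function.iterate_succ_apply, List.flatMap_singleton, iterate_flatMap_eq, List.mem_flatMap] at hx
      obtain ⟨y, hy, hxy⟩ := hx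
      have h1 := count_of_mem_colR (e + 3) j (by omega) l y hy
      have h2 := count_of_mem_iterate e j c y x hxy
      rw [show e + 3 - 2 = e + 1 by omega] at h1
      by_cases hj0 : j = 0
      · have hj1 : ¬ j = e + 1 := by omega
        simp only [if_pos hj0, if_neg hj1] at h1 h2 ⊢; omega
      · by_cases hj1 : j = e + 1
        · simp only [if_neg hj0, if_pos hj1] at h1 h2 ⊢; omega
        · simp only [if_neg hj0, if_neg hj1] at h1 h2 ⊢; omega

/-- (SUB) a sum over the codegree-`J` monomials of a weight vanishing at multiplicity `0` is the sum over ALL monomials (the support of the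
column of `x^m` lies in codegree `J`). -/
theorem sum_subtype_eq_sum_of_count (K : Type*) [Field K] (k e c J : ℕ)
    (m : {m : Fin k → Fin (e + 2) // (∑ i, (m i : ℕ)) + (J + c * (e + 1)) = k * (e + 1)})
    (g : (Fin k → Fin (e + 2)) → ℕ → K) (hg : ∀ v, g v 0 = 0) :
    (∑ v : {v : Fin k → Fin (e + 2) // (∑ i, (v i : ℕ)) + J = k * (e + 1)},
      g v.1 (((List.flatMap (colR (e + 3)))^[c] [List.ofFn (fun i => (m.1 i : ℕ))]).count (List.ofFn (fun i => (v.1 i : ℕ))))) =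
      ∑ v : Fin k → Fin (e + 2),
        g v (((List.flatMap (colR (e + 3)))^[c] [List.ofFn (fun i => (m.1 i : ℕ))]).count (List.ofFn (fun i => (v i : ℕ)))) := by
  rw [← Finset.sum_subtype (Finset.univ.filter (fun v : Fin k → Fin (e + 2) => (∑ i, (v i : ℕ)) + J = k * (e + 1)))
    (fun v => by rw [Finset.mem_filter, and_iff_right (Finset.mem_univ v)])
    (fun v : Fin k → Fin (e + 2) =>
      g v (((List.flatMap (colR (e + 3)))^[c] [List.ofFn (fun i => (m.1 i : ℕ))]).count (List.ofFn (fun i => (v i : ℕ)))))]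
  apply Finset.sum_subset (Finset.filter_subset _ _)
  intro v _ hv
  rw [Finset.mem_filter, not_and] at hv
  have hP := hv (Finset.mem_univ v)
  have h0 : ((List.flatMap (colR (e + 3)))^[c] [List.ofFn (fun i => (m.1 i : ℕ))]).count (List.ofFn (fun i => (v i : ℕ))) = 0 := by
    rw [List.count_eq_zero]
    intro hmem
    obtain ⟨w, hw, hdeg⟩ := exists_eq_ofFn_of_mem_iterate c m.1 _ hmem
    have hvw : v = w := ofFn_val_injective k e hw
    subst hvw
    have hm := m.2
    omega
  rw [h0, hg]

/-- **(STR-ℕ) STRINGS, COUNTED**: summed over the monomials `x^v` of a fixed CONTENT CLASS `n` (`#ⱼ(v) = n_j` for every exponent value `j`),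
the multiplicities of `q^c · x^m` add up to `c! · C(#Z(m), c)` if the content of `m` is the shifted class `n + c·δ_0 − c·δ_{e+1}`, and to `0`
otherwise ((SHIFT): every monomial in the support has exactly that content; (COLSUM-ℕ)). -/
theorem sum_ite_count_iterate_colR {k e : ℕ} (c : ℕ) (n : Fin (e + 2) → ℕ) (m : Fin k → Fin (e + 2)) :
    (∑ v : Fin k → Fin (e + 2),
      if (∀ j : Fin (e + 2), (List.ofFn (fun i => (v i : ℕ))).count (j : ℕ) = n j) then
        ((List.flatMap (colR (e + 3)))^[c] [List.ofFn (fun i => (m i : ℕ))]).count (List.ofFn (fun i => (v i : ℕ))) else 0) =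
      if (∀ j : Fin (e + 2), (List.ofFn (fun i => (m i : ℕ))).count (j : ℕ) + (if (j : ℕ) = e + 1 then c else 0) =
          n j + (if (j : ℕ) = 0 then c else 0)) then
        ((List.ofFn (fun i => (m i : ℕ))).count 0).descFactorial c else 0 := by
  by_cases hc : ∀ j : Fin (e + 2), (List.ofFn (fun i => (m i : ℕ))).count (j : ℕ) + (if (j : ℕ) = e + 1 then c else 0) =
      n j + (if (j : ℕ) = 0 then c else 0)
  · rw [if_pos hc, ← sum_count_iterate_colR c m]
    apply Finset.sum_congr rfl
    intro v _
    by_cases h0 : ((List.flatMap (colR (e + 3)))^[c] [List.ofFn (fun i => (m i : ℕ))]).count (List.ofFn (fun i => (v i : ℕ))) = 0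
    · rw [h0]; simp
    · have hmem := List.count_pos_iff.mp (Nat.pos_of_ne_zero h0)
      have hv : ∀ j : Fin (e + 2), (List.ofFn (fun i => (v i : ℕ))).count (j : ℕ) = n j := fun j => by
        have h1 := count_of_mem_iterate e j c _ _ hmem
        have h2 := hc j
        omega
      rw [if_pos hv]
  · rw [if_neg hc]
    apply Finset.sum_eq_zero
    intro v _
    split_ifs with hv
    · rw [List.count_eq_zero]
      intro hmem
      exact hc fun j => by
        have h1 := count_of_mem_iterate e j c _ _ hmem
        have h2 := hv j
        omega
    · rfl

/-- **(STR) STRINGS**: the indicator ROW vector `χ_n` of a content class `n` at codegree `J` (an `S_k`-INVARIANT vector; the orbit sum of the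
class) is mapped by `M_c` to `(n_0 + c)(n_0 + c − 1)⋯(n_0 + 1) · χ_{n⁺} = c! · C(n_0 + c, c) · χ_{n⁺}`, `n⁺ = n + c·δ_0 − c·δ_{e+1}` the shifted
class (written without subtraction: `#ⱼ(m) + c·[j = e+1] = n_j + c·[j = 0]`; when `n_{e+1} < c` no `m` qualifies and `χ_n ↦ 0`).  The
`S_k`-invariant vectors thus form a subcomplex of STRINGS on which the census differential acts by explicit integers. -/
theorem vecMul_indicator_eq (K : Type*) [Field K] (k e c J : ℕ) (n : Fin (e + 2) → ℕ) :
    Matrix.vecMul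
      (fun v : {v : Fin k → Fin (e + 2) // (∑ i, (v i : ℕ)) + J = k * (e + 1)} =>
        if (∀ j : Fin (e + 2), (List.ofFn (fun i => (v.1 i : ℕ))).count (j : ℕ) = n j) then (1 : K) else 0)
      (Matrix.of fun (v : {v : Fin k → Fin (e + 2) // (∑ i, (v i : ℕ)) + J = k * (e + 1)})
          (m : {m : Fin k → Fin (e + 2) // (∑ i, (m i : ℕ)) + (J + c * (e + 1)) = k * (e + 1)}) =>
        ((((List.flatMap (colR (e + 3)))^[c] [List.ofFn (fun i => (m.1 i : ℕ))]).count (List.ofFn (fun i => (v.1 i : ℕ))) : ℕ) : K)) =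
    fun m => if (∀ j : Fin (e + 2), (List.ofFn (fun i => (m.1 i : ℕ))).count (j : ℕ) + (if (j : ℕ) = e + 1 then c else 0) =
        n j + (if (j : ℕ) = 0 then c else 0)) then (((n 0 + c).descFactorial c : ℕ) : K) else 0 := by
  funext m
  rw [Matrix.vecMul, dotProduct]
  simp only [Matrix.of_apply, ite_mul, one_mul, zero_mul]
  refine (sum_subtype_eq_sum_of_count K k e c J m
    (fun v x => if (∀ j : Fin (e + 2), (List.ofFn (fun i => (v i : ℕ))).count (j : ℕ) = n j) then ((x : ℕ) : K) else 0)
    (fun v => by simp)).trans ?_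
  have h := congrArg (Nat.cast : ℕ → K) (sum_ite_count_iterate_colR c n m.1)
  rw [Nat.cast_sum] at h
  simp only [Nat.cast_ite, Nat.cast_zero] at h
  rw [h]
  split_ifs with hc
  · have h0 := hc 0
    rw [show ((0 : Fin (e + 2)) : ℕ) = 0 from rfl, if_pos rfl, if_neg (show (0 : ℕ) ≠ e + 1 by omega), add_zero] at h0
    rw [h0]
  · rfl

end Summit.HodgeConjecture.HodgeConjecture.HodgeLocus.Census.UnitColumnSums
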